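import Literature.MathematicalPhysics.AQFT.OSAxiomsSchwinger
import Literature.MathematicalPhysics.QuantumLattice.SchwartzTranslationCutoff
import HarnessLib

/-!
# Schwartz test functions with time-separated supports: translation differences and `⁰𝒮`

Support file for lattice approximations of the Osterwalder–Schrader reflection-positivity form (the
`n`-point test functions of (E2) are `ΘF* ⊗ G` with `F, G ∈ 𝒮(ℝ^{dn}_<)` time-ordered; on a lattice of
spacing `a` one meets their translates by `a e₀` in SOME of the variables, which stay in `⁰𝒮` only when the
time coordinates of the support are separated by more than `a`). Content (all proved):

* `schwartzNorm_compSubConstCLM_sub_le` — `|F(· − c) − F|_M ≤ 4^M |F|_{M+1} ‖c‖` for `‖c‖ ≤ 1`: the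
  finite-order Schwartz norms (`schwartzNorm`, OS II §2) of a translation difference are `O(‖c‖)`
  (mean value inequality, `seminorm_compSubConstCLM_sub_le`; Hörmander I §7.1);
* `exists_pos_forall_le_of_finite` — a finite family of positive reals has a positive lower bound;
* `exists_timeSep_of_isCompact` — a compact subset of the open time-ordered cone
  `{0 < x₁⁰ < ⋯ < xₙ⁰}` is UNIFORMLY separated: all times `≥ δ` and all gaps `≥ δ` for some `δ > 0`;
  `exists_timeSep_of_tsupport_subset` — the same for a test function supported in
  `tsupport F ∩ B̄(0, R)`, `F` time-ordered (the compact cutoffs of `SchwartzTranslationCutoff`), with the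
  upper bound `xᵢ⁰ ≤ R`;
* `tsupport_starTest_thetaMulti_subset`, `tsupport_compSubConstCLM_subset`, `tsupport_sub_subset` —
  support bookkeeping for conjugated/reflected/translated test functions;
* `isOffDiagonal_appendTensor_of_neg_of_pos` — `A ⊗ B ∈ ⁰𝒮` whenever `A` is supported at negative,
  pairwise distinct times and `B` at positive, pairwise distinct times (Kravchuk–Qiao–Rychkov Rem. 2.4:
  `⁰𝒮` = vanishing to infinite order on the coincidence locus; here the support misses it).

Sources: K. Osterwalder, R. Schrader, CMP 31 (1973) §2 and CMP 42 (1975) §2 (test function spaces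
`𝒮_<`, `⁰𝒮`, norms `|f|_m`); L. Hörmander, ALPDO I, §7.1. Mathlib: `SchwartzMap.compSubConstCLM`,
`IsCompact.exists_isMinOn`, `tsupport`.
-/

open scoped SchwartzMap ComplexConjugate
open Set Filter

namespace Literature.MathematicalPhysics.QuantumLattice

/-! ### Translation differences in the finite-order Schwartz norms -/

section TranslationDifference

variable {X : Type*} [NormedAddCommGroup X] [NormedSpace ℝ X]

/-- Real and complex Schwartz seminorms of a complex test function agree (both are the best constant
in the defining estimate). [folklore] -/
theorem schwartzSeminorm_real_eq_complex (k l : ℕ) (F : 𝓢(X, ℂ)) :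
    SchwartzMap.seminorm ℝ k l F = SchwartzMap.seminorm ℂ k l F := rfl

/-- **Translation differences are `O(‖c‖)` in every finite-order Schwartz norm**:
`|F(· − c) − F|_M ≤ 4^M · |F|_{M+1} · ‖c‖` for `‖c‖ ≤ 1` (mean value inequality applied to `Dˡ F`,
one extra derivative; Hörmander I §7.1). [folklore] -/
theorem schwartzNorm_compSubConstCLM_sub_le (M : ℕ) (F : 𝓢(X, ℂ)) {c : X} (hc : ‖c‖ ≤ 1) :
    schwartzNorm M (SchwartzMap.compSubConstCLM ℂ c F - F) ≤
      4 ^ M * schwartzNorm (M + 1) F * ‖c‖ := by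
  have hN0 : 0 ≤ schwartzNorm (M + 1) F := schwartzNorm_nonneg _ _
  unfold schwartzNorm
  refine Seminorm.finset_sup_apply_le (by unfold schwartzNorm at hN0; positivity) fun i hi => ?_
  rw [Finset.mem_Iic, Prod.le_def] at hi
  rw [SchwartzMap.schwartzSeminormFamily_apply, ← schwartzSeminorm_real_eq_complex]
  refine (seminorm_compSubConstCLM_sub_le ℂ F i.1 i.2 hc).trans ?_
  have hsup : ((Finset.Iic (i.1, i.2 + 1)).sup (schwartzSeminormFamily ℝ X ℂ)) F ≤
      ((Finset.Iic (M + 1, M + 1)).sup (schwartzSeminormFamily ℂ X ℂ)) F := by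
    refine Seminorm.finset_sup_apply_le (by unfold schwartzNorm at hN0; exact hN0) fun j hj => ?_
    rw [Finset.mem_Iic, Prod.le_def] at hj
    rw [SchwartzMap.schwartzSeminormFamily_apply, schwartzSeminorm_real_eq_complex]
    exact seminorm_le_schwartzNorm (by omega) (by omega) F
  have h4 : (2 : ℝ) ^ i.1 * 2 ^ i.1 ≤ 4 ^ M := by
    rw [← mul_pow, show (2 : ℝ) * 2 = 4 by norm_num]
    exact pow_le_pow_right₀ (by norm_num) hi.1
  have hsup0 : 0 ≤ ((Finset.Iic (i.1, i.2 + 1)).sup (schwartzSeminormFamily ℝ X ℂ)) F :=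
    apply_nonneg _ _
  calc (2 : ℝ) ^ i.1 * 2 ^ i.1 * ((Finset.Iic (i.1, i.2 + 1)).sup (schwartzSeminormFamily ℝ X ℂ)) F * ‖c‖
      ≤ 4 ^ M * ((Finset.Iic (M + 1, M + 1)).sup (schwartzSeminormFamily ℂ X ℂ)) F * ‖c‖ := by
        gcongr
    _ = _ := rfl

end TranslationDifference

/-! ### Uniform time separation of compact subsets of the time-ordered cone -/

/-- A finite family of positive reals has a positive common lower bound. [folklore] -/
theorem exists_pos_forall_le_of_finite {ι : Type*} [Finite ι] {δ : ι → ℝ} (hδ : ∀ s, 0 < δ s) :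
    ∃ δ₀ : ℝ, 0 < δ₀ ∧ ∀ s, δ₀ ≤ δ s := by
  classical
  cases isEmpty_or_nonempty ι with
  | inl h => exact ⟨1, one_pos, fun s => (IsEmpty.false s).elim⟩
  | inr h =>
    haveI := Fintype.ofFinite ι
    exact ⟨Finset.univ.inf' Finset.univ_nonempty δ, (Finset.lt_inf'_iff _).2 fun s _ => hδ s,
      fun s => Finset.inf'_le _ (Finset.mem_univ s)⟩

section TimeSep

variable {d : ℕ} [NeZero d] {n : ℕ}

/-- **Uniform time separation**: a compact set of `n`-point configurations inside the open time-ordered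
cone `{0 < x₁⁰ < ⋯ < xₙ⁰}` has all times `≥ δ` and all time gaps `≥ δ` for one `δ > 0` (each of the
finitely many continuous functions `x ↦ xᵢ⁰`, `x ↦ xⱼ⁰ − xᵢ⁰` attains a positive minimum). [folklore] -/
theorem exists_timeSep_of_isCompact {K : Set (Fin n → EuclideanSpace ℝ (Fin d))} (hK : IsCompact K)
    (hsub : K ⊆ {x | (∀ i, 0 < x i 0) ∧ StrictMono fun i => x i 0}) :
    ∃ δ : ℝ, 0 < δ ∧ ∀ x ∈ K, (∀ i, δ ≤ x i 0) ∧ ∀ i j, i < j → x i 0 + δ ≤ x j 0 := by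
  rcases K.eq_empty_or_nonempty with rfl | hne
  · exact ⟨1, one_pos, fun x hx => (Set.notMem_empty x hx).elim⟩
  have hc0 : ∀ i : Fin n, Continuous fun x : Fin n → EuclideanSpace ℝ (Fin d) => x i 0 := fun i =>
    (PiLp.continuous_apply (p := 2) (β := fun _ : Fin d => ℝ) 0).comp (continuous_apply i)
  let g : Fin n ⊕ {p : Fin n × Fin n // p.1 < p.2} → (Fin n → EuclideanSpace ℝ (Fin d)) → ℝ :=
    fun s x => Sum.elim (fun i => x i 0) (fun p => x p.1.2 0 - x p.1.1 0) s
  have hg : ∀ s, Continuous (g s) := by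
    rintro (i | p)
    · exact hc0 i
    · exact (hc0 p.1.2).sub (hc0 p.1.1)
  have hpos : ∀ s, ∀ x ∈ K, 0 < g s x := by
    rintro (i | p) x hx
    · exact (hsub hx).1 i
    · exact sub_pos.2 ((hsub hx).2 p.2)
  have hδ : ∀ s, ∃ δ : ℝ, 0 < δ ∧ ∀ x ∈ K, δ ≤ g s x := fun s => by
    obtain ⟨x₀, hx₀, hmin⟩ := hK.exists_isMinOn hne (hg s).continuousOn
    exact ⟨g s x₀, hpos s x₀ hx₀, fun x hx => hmin hx⟩
  choose δ hδpos hδle using hδ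
  obtain ⟨δ₀, hδ₀, hδ₀le⟩ := exists_pos_forall_le_of_finite hδpos
  refine ⟨δ₀, hδ₀, fun x hx => ⟨fun i => (hδ₀le (Sum.inl i)).trans (hδle _ x hx), fun i j hij => ?_⟩⟩
  have h := (hδ₀le (Sum.inr ⟨(i, j), hij⟩)).trans (hδle _ x hx)
  change δ₀ ≤ x j 0 - x i 0 at h
  linarith

/-- The time coordinate of each point of a configuration is bounded by its (sup) norm. [folklore] -/
theorem apply_zero_le_norm (x : Fin n → EuclideanSpace ℝ (Fin d)) (i : Fin n) : x i 0 ≤ ‖x‖ :=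
  (le_abs_self _).trans (((Real.norm_eq_abs _).symm.le.trans (PiLp.norm_apply_le (x i) 0)).trans
    (norm_le_pi_norm x i))

/-- **Separated slab of a compact cutoff**: if `u` is supported inside `tsupport F ∩ B̄(0, R)` for a
time-ordered `F`, then for some `δ > 0` every point `x` of `tsupport u` has all times in `[δ, R]` and all
time gaps `≥ δ` (compactness of `tsupport u` inside the open time-ordered cone). [folklore] -/
theorem exists_timeSep_of_tsupport_subset {F u : 𝓢((Fin n → EuclideanSpace ℝ (Fin d)), ℂ)}
    (hF : IsTimeOrdered F) {R : ℝ}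
    (hu : tsupport (u : (Fin n → EuclideanSpace ℝ (Fin d)) → ℂ) ⊆
      tsupport (F : (Fin n → EuclideanSpace ℝ (Fin d)) → ℂ) ∩ Metric.closedBall 0 R) :
    ∃ δ : ℝ, 0 < δ ∧ tsupport (u : (Fin n → EuclideanSpace ℝ (Fin d)) → ℂ) ⊆
      {x | (∀ i, δ ≤ x i 0 ∧ x i 0 ≤ R) ∧ ∀ i j, i < j → x i 0 + δ ≤ x j 0} := by
  have hK : IsCompact (tsupport (u : (Fin n → EuclideanSpace ℝ (Fin d)) → ℂ)) :=
    (isCompact_closedBall (0 : Fin n → EuclideanSpace ℝ (Fin d)) R).of_isClosed_subset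
      (isClosed_tsupport _) (hu.trans Set.inter_subset_right)
  obtain ⟨δ, hδ, hsep⟩ := exists_timeSep_of_isCompact hK ((hu.trans Set.inter_subset_left).trans hF)
  refine ⟨δ, hδ, fun x hx => ⟨fun i => ⟨(hsep x hx).1 i, ?_⟩, (hsep x hx).2⟩⟩
  have hR : ‖x‖ ≤ R := mem_closedBall_zero_iff.1 (hu hx).2
  exact (apply_zero_le_norm x i).trans hR

end TimeSep

/-! ### Supports of conjugated, reflected and translated test functions -/

section Supports

variable {E : Type*} [NormedAddCommGroup E] [NormedSpace ℝ E] {n : ℕ}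

/-- The support of a difference lies in the union of the supports. [folklore] -/
theorem tsupport_sub_subset (F G : 𝓢(E, ℂ)) :
    tsupport ((F - G : 𝓢(E, ℂ)) : E → ℂ) ⊆ tsupport (F : E → ℂ) ∪ tsupport (G : E → ℂ) := by
  rw [sub_eq_add_neg]
  refine (tsupport_add (F : E → ℂ) ((-G : 𝓢(E, ℂ)) : E → ℂ)).trans (union_subset_union_right _ ?_)
  exact (tsupport_neg (G : E → ℂ)).le

/-- The support of a translate `F(· − c)` is contained in the translated support. [folklore] -/
theorem tsupport_compSubConstCLM_subset (c : E) (F : 𝓢(E, ℂ)) :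
    tsupport ((SchwartzMap.compSubConstCLM ℂ c F : 𝓢(E, ℂ)) : E → ℂ) ⊆ {x | x - c ∈ tsupport (F : E → ℂ)} :=
  tsupport_comp_subset_preimage (F : E → ℂ) (f := fun x => x - c) (continuous_id.sub continuous_const)

variable {d : ℕ} [NeZero d]

/-- The support of `conj F(θ ·)` (`starTest (thetaMulti d F)`) is contained in the reflected support.
[folklore] -/
theorem tsupport_starTest_thetaMulti_subset (F : 𝓢((Fin n → EuclideanSpace ℝ (Fin d)), ℂ)) :
    tsupport ((starTest (thetaMulti d F) : 𝓢((Fin n → EuclideanSpace ℝ (Fin d)), ℂ)) :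
        (Fin n → EuclideanSpace ℝ (Fin d)) → ℂ) ⊆
      {x | (fun i => timeReflection d (x i)) ∈ tsupport (F : (Fin n → EuclideanSpace ℝ (Fin d)) → ℂ)} := by
  have hψ : Continuous fun (x : Fin n → EuclideanSpace ℝ (Fin d)) i => timeReflection d (x i) :=
    continuous_pi fun i => (timeReflection d).continuous.comp (continuous_apply i)
  have hfun : ((starTest (thetaMulti d F) : 𝓢((Fin n → EuclideanSpace ℝ (Fin d)), ℂ)) :
      (Fin n → EuclideanSpace ℝ (Fin d)) → ℂ) =
      star ∘ ((F : (Fin n → EuclideanSpace ℝ (Fin d)) → ℂ) ∘ fun x i => timeReflection d (x i)) := by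
    funext x; simp [starTest_apply, thetaMulti_apply]
  rw [hfun]
  refine (closure_mono fun x hx => ?_).trans (tsupport_comp_subset_preimage _ hψ)
  simpa [Function.mem_support] using hx

end Supports

/-! ### Tensor products of time-separated test functions are in `⁰𝒮` -/

section OffDiagonal

open Literature.MathematicalPhysics.AQFT

variable {d : ℕ} [NeZero d] {n m : ℕ}

/-- **`A ⊗ B ∈ ⁰𝒮` for time-separated factors**: if `A` is supported at configurations with negative,
pairwise distinct times and `B` at configurations with positive, pairwise distinct times, then the tensor
product in appended variables vanishes to infinite order on the coincidence locus (its support misses it).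
[cite: KravchukQiaoRychkov2021, Remark 2.4] -/
theorem isOffDiagonal_appendTensor_of_neg_of_pos
    {A : 𝓢((Fin n → EuclideanSpace ℝ (Fin d)), ℂ)} {B : 𝓢((Fin m → EuclideanSpace ℝ (Fin d)), ℂ)}
    (hA : tsupport (A : (Fin n → EuclideanSpace ℝ (Fin d)) → ℂ) ⊆
      {x | (∀ i, x i 0 < 0) ∧ Function.Injective fun i => x i 0})
    (hB : tsupport (B : (Fin m → EuclideanSpace ℝ (Fin d)) → ℂ) ⊆
      {x | (∀ i, 0 < x i 0) ∧ Function.Injective fun i => x i 0}) :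
    IsOffDiagonal (A.appendTensor B) := by
  apply IsOffDiagonal.of_tsupport_subset
  let S : Set (Fin (n + m) → EuclideanSpace ℝ (Fin d)) :=
    {z | z ∘ Fin.castAdd m ∈ tsupport (A : (Fin n → EuclideanSpace ℝ (Fin d)) → ℂ) ∧
      z ∘ Fin.natAdd n ∈ tsupport (B : (Fin m → EuclideanSpace ℝ (Fin d)) → ℂ)}
  have hc1 : Continuous fun z : Fin (n + m) → EuclideanSpace ℝ (Fin d) => z ∘ Fin.castAdd m :=
    continuous_pi fun i => continuous_apply _
  have hc2 : Continuous fun z : Fin (n + m) → EuclideanSpace ℝ (Fin d) => z ∘ Fin.natAdd n :=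
    continuous_pi fun i => continuous_apply _
  have hS : IsClosed S := ((isClosed_tsupport _).preimage hc1).inter ((isClosed_tsupport _).preimage hc2)
  have hsupp : Function.support (A.appendTensor B : (Fin (n + m) → EuclideanSpace ℝ (Fin d)) → ℂ) ⊆ S := by
    intro z hz
    rw [Function.mem_support, SchwartzMap.appendTensor_apply] at hz
    exact ⟨subset_closure (Function.mem_support.2 (left_ne_zero_of_mul hz)),
      subset_closure (Function.mem_support.2 (right_ne_zero_of_mul hz))⟩
  refine (closure_minimal hsupp hS).trans ?_
  rintro z ⟨hz1, hz2⟩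
  obtain ⟨hneg, hinj1⟩ := hA hz1
  obtain ⟨hpos, hinj2⟩ := hB hz2
  refine not_mem_coincidenceLocus_of_injective fun p q hpq => ?_
  have ht : z p 0 = z q 0 := by rw [hpq]
  induction p using Fin.addCases with
  | left i =>
    induction q using Fin.addCases with
    | left j => exact congrArg (Fin.castAdd m) (hinj1 (by simpa using ht))
    | right j =>
      exfalso
      have h1 := hneg i; have h2 := hpos j
      simp only [Function.comp_apply] at h1 h2
      linarith
  | right i =>
    induction q using Fin.addCases with
    | left j =>
      exfalso
      have h1 := hpos i; have h2 := hneg j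
      simp only [Function.comp_apply] at h1 h2
      linarith
    | right j => exact congrArg (Fin.natAdd n) (hinj2 (by simpa using ht))

end OffDiagonal

end Literature.MathematicalPhysics.QuantumLattice
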